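import Literature.MathematicalPhysics.QuantumFieldTheory.Balaban1983to89.Node00.Record12BgRowCoClassC1
import Literature.MathematicalPhysics.QuantumFieldTheory.Balaban1983to89.Node00.CriticalOnFibreTopGuardedB

/-!
# NODE 00 — ROW P11: THE C¹ SENTENCE OF [15] THEOREM 1 OVER A **BOND-LEVEL DETERMINING DATUM**, A **TOP-DATA PREDICATE** AND A **PREFIX GUARD** —
# `VariationalThm1C1RegSepTop7MGB ∕ …CoP7MGB F N [Sup] Adm bd Dat B₃ B₃' a₀ a₁`: node00-def-P11's `Record12BgRowCoClassC1` §1∕§3 parametrised exactly as k0-s1-w1's S1a-C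
# (`Record12BgRowCoClassCPMFloorB`) parametrised the (8)-sentence; the (b)-instance sentences are the instance `((fun _ … => True), genSetDatum F, dataSmall7PTopOf F N)`; the pointwise accessor

Cell `pub-ymgap`, seat `pub-ymgap-node00-def-K0a` g10 (K0⁷ **stmt-QuantumFields-20541** helper lane; (E1)∕(iii-b) Stage-2 coherence train, director-ym №343 (D5)∕(D6), №345 (item (6)
`Node00/Record13SepCoPInhabitedOfThm1CoP7MC1` = Cut B″ keyed on the C¹ sentence), №346, №350; FLAG №16 ∕ LOCATE-HSEAM 5d3298b8d191f169).  `--kind definition --supports stmt-QuantumFields-20541`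
(count-neutral).  [15] = [Balaban1985Variational]; [6] = [Balaban1985RegularSpaces]; [II] = [Balaban1984PropagatorsII]; [III] = [Balaban1988Convergent]; [I] = [Balaban1987RG1].

HONESTY GUARD (№338 (5)).  PURELY ADDITIVE: print-datum parametrisation of `Node00/Record12BgRowCoClassC1` §1∕§3 (FLAG №16 ∕ LOCATE-HSEAM 5d3298b8d191f169); the (b)-instances
`VariationalThm1C1RegSepTop7M ∕ VariationalThm1C1RegSepCoP7M` stay landed and true on their own text (`variationalThm1C1RegSepTop7M_iff_GB_top` ∕ `…CoP7M_iff_GB_top` below); NOTHING in that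
module is edited; no displayed premise of the sentence is deleted or weakened — the data row and the minimiser's datum become PARAMETERS `(Dat, bd)`, a prefix guard `Adm` is ADDED as one more
antecedent (the (b)-road is the trivial guard), and the old sentence is one instance.

WHY.  The Stage-2 coherence train re-keys node00-def-K0a's FILE 16d `Record13SepCoPInhabitedOfThm1CoP7MC1` (Cut B″: the K0 body at `θ₁₅ᶜᶜ¹` from the (8)-sentence AND the C¹ sentence) onto
print's (2.3) datum: after node00-def-R's seam re-point the record's background above level `0` is `UbgMSCoPOfRecordB … s 𝐖`, a minimiser on the `lamBondsSeq s.Ω k`-fibre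
(`isMinimizerB_UbgMSCoPOfRecordB`), so the C¹ sentence it consumes must quantify over `IsMinimizerB … (bd K k s.Ω) W U₀` with `bd := lamDatum F` — this file is that sentence, with the
same `(Adm, bd, Dat)` parameters as S1a-C's `VariationalThm1RegSepTop7MGB` and S1b-2's `VariationalThm1GaugeRegSepTop7MGB` so that one guard and one datum serve all three.

WHAT IS HERE (sorry-free; TWO definitions (named facts, `Prop`s with parameters, NEVER asserted) + bookkeeping).
* §1 `VariationalThm1C1RegSepTop7MGB F N Sup Adm bd Dat B₃ B₃' a₀ a₁` ∕ `VariationalThm1C1RegSepCoP7MGB F N Adm bd Dat B₃ B₃' a₀ a₁` (module C1 §1∕§3's bodies with the two rows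
  parametrised and the guard antecedent `Adm ν M g K k s` added after `0 < ν.M₁`; every other byte identical); `variationalThm1C1RegSepTop7M_iff_GB_top ∕ …CoP7M_iff_GB_top` (the
  (b)-sentences ARE the instance `((fun _ _ _ _ _ _ => True), genSetDatum F, dataSmall7PTopOf F N)`: F0a's `IsMinimizer … 𝔹 = IsMinimizerB … (bondsDet 𝔹)` and F0c's `dataSmall7PTopOf` are
  definitional, the guard `True` is dropped∕supplied); bridges `.toTop7MGB ∕ .toCoP7MGB`; `.of_le` (antitone in `a₀ a₁`), `.mono` (monotone in `B₃'`), `.of_imp` (antitone in the guard),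
  `.of_imp_dat` (antitone in the data predicate).
* §2 the pointwise accessor `plaqC1SmallOn_of_thm1C1RegSepTop7MGB` (module C1 §2's `plaqC1SmallOn_of_thm1C1RegSepTop7M` over `(Adm, bd, Dat)`).
NOT HERE: the record-level accessor at node00-def-R's `UbgMSCoPOfRecordB` (two terms, inlined by the consumer FILE 16d: this accessor ∘ `isMinimizerB_UbgMSCoPOfRecordB`), any CONCRETE guard
or datum, anything of [15]'s analysis.
HONEST SCOPE.  Definitions of named facts + binder-threading bookkeeping; nothing of [15] asserted or proved; no (b)-instance fact is claimed false (FLAG №16 concerns which instance print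
PROVES); K0⁷ stub 1 NOT closed; N07 NOT discharged; counts unmoved (typed 28∕28 · discharged 8∕28); one finite 𝕋⁴ programme at fixed ε — the route closes the conditional finite-𝕋⁴ rung
`BalabanLadder.UV` only; nothing continuum ∕ ℝ⁴ ∕ OS; the Yang–Mills mass gap (Clay) is NOT proved by any of this.  No `sorry`, no `instance`, no `notation`.

References: [15] (1)–(2) p.277–278, (6)–(7) p.278, Thm 1 (9)–(10) p.279, p.304 lines 1–2; [6] (1.3)–(1.9) p.77; [II] (2.3) p.224; [III] p.255, (2.6)–(2.8) pp.255–256, (2.10)–(2.12)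
p.256, (2.38) p.261; [I] (0.1) p.251.
-/

noncomputable section

open MeasureTheory
open scoped Matrix.Norms.L2Operator

namespace Literature.MathematicalPhysics.QuantumFieldTheory.Balaban1983to89.Node00

open T4Continuum (T4Family)
open B15DeterminingSets B15DeterminingSetsB B12RegularSpaces111

/-! ## §1  The guarded C¹ sentences over `(bd, Dat)` and their API -/

section NamedFactC1TopMGB

variable (F : T4Family) (N : ℕ) [NeZero N]

/-- **[15] THEOREM 1 (9)–(10), GAUGE-INVARIANT C¹ READING (CONSEQUENCE FORM), GUARD-GENERIC, OVER A BOND DATUM AND A TOP-DATA PREDICATE**: module C1's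
`VariationalThm1C1RegSepTop7M` with the data row `Dat K s.Ω (Sup ν K s.Ω) k δ W`, the minimiser row `IsMinimizerB (avOfRecord F N K) {class (6)-Top at ε₀} (bd K k s.Ω) W U₀` and ONE more
antecedent, the prefix guard `Adm ν M g K k s`; every other byte identical (conclusion: at every scale `1 ≤ n ≤ k`, `PlaqC1SmallOn (plaqInside (s.Ω n)) (B₃'·δ_n·η_n³) U₀`).  A `Prop` with
parameters, NEVER asserted; the K0 skeleton names a CONCRETE guard and datum (never free ones).  Print-datum parametrisation of `VariationalThm1C1RegSepTop7M` (FLAG №16 ∕ LOCATE-HSEAM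
5d3298b8d191f169); the (b)-instance `VariationalThm1C1RegSepTop7M` stays landed and true on its own text (`variationalThm1C1RegSepTop7M_iff_GB_top`).  HONEST LABEL as in module C1: a
gauge-invariant READING of print's (9)–(10) (axial-type gauges on the class cubes, `|∇^ηA| < B₃Mε₁(L^jη)⁻²` …), NOT verbatim; `B₃'` absorbs `B₃·M` at the cube sizes of record.
-- TODO(general form): print states (9)–(10) in an axial-type gauge on the class cubes with Hölder member `B₄(β₀)` and ONE threshold ε₁; general admissible `{Ω_j}`∕`𝔅_k` ([6] Sect. A)
-- and print's separation letter `R ≥ R₁`; orbit uniqueness is not part of this sentence.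
[cite: Balaban1985Variational, (1) p.277, Thm 1 (2),(3),(5),(6),(7),(9)–(10) pp.278–279, p.304 lines 1–2; Balaban1985RegularSpaces, (1.3)–(1.9) p.77; Balaban1984PropagatorsII, (2.3) p.224; Balaban1988Convergent, p.255, (2.6)–(2.8) pp.255–256, (2.10)–(2.12) p.256, (2.38) p.261; Balaban1987RG1, (0.1) p.251] -/
def VariationalThm1C1RegSepTop7MGB (Sup : (ν : Stage7Numerics) → (K : ℕ) → (ℕ → Set (Site (F.P K) 0)) → Set (Site (F.P K) 0)) (Adm : StepGuard F) (bd : BondDatum F) (Dat : TopData F N)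
    (B₃ B₃' a₀ a₁ : ℝ) : Prop :=
  ∀ (ν : Stage7Numerics) (M : ℕ) (g : ℕ → ℝ) (K k : ℕ) (s : SeqOfRecord F ν M g K k), Sect2.SeqSeparated ν.M₁ s → 0 < ν.M₁ → Adm ν M g K k s → ∀ (ε₀ : ℝ) (δ : ℕ → ℝ),
    (∀ n, n ≤ k → 0 < δ n ∧ δ n ≤ a₁ ∧ B₃ * δ n ≤ ε₀) → (∀ n, n < k → δ n ≤ 2 * δ (n + 1)) → (∀ n, n < k → δ (n + 1) ≤ 2 * δ n) → ε₀ ≤ a₀ →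
    ∀ W : MSField (F.P K) (SU N), Dat K s.Ω (Sup ν K s.Ω) k δ W →
      ∀ U₀, IsMinimizerB (avOfRecord F N K)
          {U | (∀ n, n ≤ k → PlaqSmallOn (Sect2.omegaPlaqsTop s.Ω (Sup ν K s.Ω) n) (ε₀ * (F.P K).eta n ^ 2) U) ∧
            Sect2.CoDivClassOnTop s.Ω (Sup ν K s.Ω) k ε₀ U} (bd K k s.Ω) W U₀ →
        ∀ n, 1 ≤ n → n ≤ k → PlaqC1SmallOn (plaqInside (s.Ω n)) (B₃' * δ n * (F.P K).eta n ^ 3) U₀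

/-- **THE `CoP` EDITION OVER `(bd, Dat)`**: §1's sentence at node00-def-R's selector `Sup := suppDomOfRecord` (module C1 §3's `VariationalThm1C1RegSepCoP7M` with the two rows parametrised
and the guard added). [cite: Balaban1985Variational, Thm 1 (7),(9)–(10) pp.278–279, p.304 lines 1–2; Balaban1985RegularSpaces, (1.3)–(1.6) p.77; Balaban1984PropagatorsII, (2.3) p.224; Balaban1988Convergent, p.255, (2.12) p.256] -/
def VariationalThm1C1RegSepCoP7MGB (Adm : StepGuard F) (bd : BondDatum F) (Dat : TopData F N) (B₃ B₃' a₀ a₁ : ℝ) : Prop :=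
  VariationalThm1C1RegSepTop7MGB F N (fun ν K Ω => suppDomOfRecord F ν K Ω) Adm bd Dat B₃ B₃' a₀ a₁

variable {F N}

/-! ### The instances of record: module C1's sentences at the trivial guard -/

/-- Module C1's `VariationalThm1C1RegSepTop7M` IS the instance `((fun _ _ _ _ _ _ => True), genSetDatum F, dataSmall7PTopOf F N)` (F0a's `IsMinimizer … 𝔹 = IsMinimizerB … (bondsDet 𝔹)` and
F0c's `dataSmall7PTopOf` are definitional; the trivial guard is supplied ∕ dropped). [cite: Balaban1985Variational, Thm 1 (9)–(10) p.279; Balaban1988Convergent, (2.10)–(2.12) p.256; Balaban1987RG1, (0.1) p.251] -/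
theorem variationalThm1C1RegSepTop7M_iff_GB_top {Sup : (ν : Stage7Numerics) → (K : ℕ) → (ℕ → Set (Site (F.P K) 0)) → Set (Site (F.P K) 0)} {B₃ B₃' a₀ a₁ : ℝ} :
    VariationalThm1C1RegSepTop7M F N Sup B₃ B₃' a₀ a₁ ↔ VariationalThm1C1RegSepTop7MGB F N Sup (fun _ _ _ _ _ _ => True) (genSetDatum F) (dataSmall7PTopOf F N) B₃ B₃' a₀ a₁ :=
  ⟨fun h ν M g K k s hsep hM₁ _ => h ν M g K k s hsep hM₁, fun h ν M g K k s hsep hM₁ => h ν M g K k s hsep hM₁ trivial⟩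

/-- Module C1's `VariationalThm1C1RegSepCoP7M` IS the instance `((fun _ _ _ _ _ _ => True), genSetDatum F, dataSmall7PTopOf F N)` of the `CoP` edition.
[cite: Balaban1985Variational, Thm 1 (9)–(10) p.279; Balaban1988Convergent, (2.12) p.256] -/
theorem variationalThm1C1RegSepCoP7M_iff_GB_top {B₃ B₃' a₀ a₁ : ℝ} :
    VariationalThm1C1RegSepCoP7M F N B₃ B₃' a₀ a₁ ↔ VariationalThm1C1RegSepCoP7MGB F N (fun _ _ _ _ _ _ => True) (genSetDatum F) (dataSmall7PTopOf F N) B₃ B₃' a₀ a₁ :=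
  variationalThm1C1RegSepTop7M_iff_GB_top

/-! ### Bridges `Top ↔ CoP` and the API -/

/-- Definitional bridge (`CoP` ⇒ `Top` at the selector of record). [cite: Balaban1985Variational, Thm 1 (9)–(10) p.279 (bookkeeping)] -/
theorem VariationalThm1C1RegSepCoP7MGB.toTop7MGB {Adm : StepGuard F} {bd : BondDatum F} {Dat : TopData F N} {B₃ B₃' a₀ a₁ : ℝ}
    (h : VariationalThm1C1RegSepCoP7MGB F N Adm bd Dat B₃ B₃' a₀ a₁) : VariationalThm1C1RegSepTop7MGB F N (fun ν K Ω => suppDomOfRecord F ν K Ω) Adm bd Dat B₃ B₃' a₀ a₁ := h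

/-- Conversely (definitional). [cite: Balaban1985Variational, Thm 1 (9)–(10) p.279 (bookkeeping)] -/
theorem VariationalThm1C1RegSepTop7MGB.toCoP7MGB {Adm : StepGuard F} {bd : BondDatum F} {Dat : TopData F N} {B₃ B₃' a₀ a₁ : ℝ}
    (h : VariationalThm1C1RegSepTop7MGB F N (fun ν K Ω => suppDomOfRecord F ν K Ω) Adm bd Dat B₃ B₃' a₀ a₁) : VariationalThm1C1RegSepCoP7MGB F N Adm bd Dat B₃ B₃' a₀ a₁ := h

/-- Antitone in the ceilings `a₀ a₁`. [cite: Balaban1985Variational, Thm 1 p.279 (the range «ε₀ ≤ a₀», «ε₁ ≤ a₁»)] -/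
theorem VariationalThm1C1RegSepTop7MGB.of_le {Sup : (ν : Stage7Numerics) → (K : ℕ) → (ℕ → Set (Site (F.P K) 0)) → Set (Site (F.P K) 0)} {Adm : StepGuard F} {bd : BondDatum F}
    {Dat : TopData F N} {B₃ B₃' a₀ a₀' a₁ a₁' : ℝ} (h : VariationalThm1C1RegSepTop7MGB F N Sup Adm bd Dat B₃ B₃' a₀ a₁) (ha₀ : a₀' ≤ a₀) (ha₁ : a₁' ≤ a₁) :
    VariationalThm1C1RegSepTop7MGB F N Sup Adm bd Dat B₃ B₃' a₀' a₁' :=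
  fun ν M g K k s hsep hM₁ hadm ε₀ δ hnum hcomp hcomp' hε W h7 U₀ hmin =>
    h ν M g K k s hsep hM₁ hadm ε₀ δ (fun n hn => ⟨(hnum n hn).1, (hnum n hn).2.1.trans ha₁, (hnum n hn).2.2⟩) hcomp hcomp' (hε.trans ha₀) W h7 U₀ hmin

/-- Monotone in the C¹ constant `B₃'` (a larger constant is a weaker conclusion). [cite: Balaban1985Variational, Thm 1 (9)–(10) p.279 (bookkeeping)] -/
theorem VariationalThm1C1RegSepTop7MGB.mono {Sup : (ν : Stage7Numerics) → (K : ℕ) → (ℕ → Set (Site (F.P K) 0)) → Set (Site (F.P K) 0)} {Adm : StepGuard F} {bd : BondDatum F}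
    {Dat : TopData F N} {B₃ B₃' B₃'' a₀ a₁ : ℝ} (h : VariationalThm1C1RegSepTop7MGB F N Sup Adm bd Dat B₃ B₃' a₀ a₁) (hB : B₃' ≤ B₃'') :
    VariationalThm1C1RegSepTop7MGB F N Sup Adm bd Dat B₃ B₃'' a₀ a₁ :=
  fun ν M g K k s hsep hM₁ hadm ε₀ δ hnum hcomp hcomp' hε W h7 U₀ hmin n hn1 hnk =>
    (h ν M g K k s hsep hM₁ hadm ε₀ δ hnum hcomp hcomp' hε W h7 U₀ hmin n hn1 hnk).of_le
      (mul_le_mul_of_nonneg_right (mul_le_mul_of_nonneg_right hB (hnum n hnk).1.le) (pow_nonneg (by unfold Params.eta; positivity) 3))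

/-- ANTITONE IN THE GUARD: a stronger guard `Adm′ ⇒ Adm` asks the sentence of fewer prefixes. [cite: Balaban1985Variational, Thm 1 (9)–(10) p.279; Balaban1987RG1, (0.1) p.251 (bookkeeping)] -/
theorem VariationalThm1C1RegSepTop7MGB.of_imp {Sup : (ν : Stage7Numerics) → (K : ℕ) → (ℕ → Set (Site (F.P K) 0)) → Set (Site (F.P K) 0)} {Adm Adm' : StepGuard F} {bd : BondDatum F}
    {Dat : TopData F N} {B₃ B₃' a₀ a₁ : ℝ} (h : VariationalThm1C1RegSepTop7MGB F N Sup Adm bd Dat B₃ B₃' a₀ a₁) (himp : ∀ ν M g K k s, Adm' ν M g K k s → Adm ν M g K k s) :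
    VariationalThm1C1RegSepTop7MGB F N Sup Adm' bd Dat B₃ B₃' a₀ a₁ :=
  fun ν M g K k s hsep hM₁ hadm' => h ν M g K k s hsep hM₁ (himp ν M g K k s hadm')

/-- ANTITONE IN THE DATA PREDICATE: a WEAKER data hypothesis `Dat′ ⇒ Dat` pointwise gives a STRONGER sentence. [cite: Balaban1985Variational, (7) p.278, Thm 1 (9)–(10) p.279 (bookkeeping)] -/
theorem VariationalThm1C1RegSepTop7MGB.of_imp_dat {Sup : (ν : Stage7Numerics) → (K : ℕ) → (ℕ → Set (Site (F.P K) 0)) → Set (Site (F.P K) 0)} {Adm : StepGuard F} {bd : BondDatum F}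
    {Dat Dat' : TopData F N} {B₃ B₃' a₀ a₁ : ℝ} (h : VariationalThm1C1RegSepTop7MGB F N Sup Adm bd Dat B₃ B₃' a₀ a₁)
    (himp : ∀ (K : ℕ) (Ω : ℕ → Set (Site (F.P K) 0)) (Ω₀ : Set (Site (F.P K) 0)) (k : ℕ) (δ : ℕ → ℝ) (W : MSField (F.P K) (SU N)), Dat' K Ω Ω₀ k δ W → Dat K Ω Ω₀ k δ W) :
    VariationalThm1C1RegSepTop7MGB F N Sup Adm bd Dat' B₃ B₃' a₀ a₁ :=
  fun ν M g K k s hsep hM₁ hadm ε₀ δ hnum hcomp hcomp' hε W h7 => h ν M g K k s hsep hM₁ hadm ε₀ δ hnum hcomp hcomp' hε W (himp _ _ _ _ _ _ h7)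

/-- The `CoP` edition is ANTITONE in `a₀`, `a₁`. [cite: Balaban1985Variational, Thm 1 p.279 (the range «ε₀ ≤ a₀», «ε₁ ≤ a₁»)] -/
theorem VariationalThm1C1RegSepCoP7MGB.of_le {Adm : StepGuard F} {bd : BondDatum F} {Dat : TopData F N} {B₃ B₃' a₀ a₀' a₁ a₁' : ℝ}
    (h : VariationalThm1C1RegSepCoP7MGB F N Adm bd Dat B₃ B₃' a₀ a₁) (ha₀ : a₀' ≤ a₀) (ha₁ : a₁' ≤ a₁) : VariationalThm1C1RegSepCoP7MGB F N Adm bd Dat B₃ B₃' a₀' a₁' :=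
  VariationalThm1C1RegSepTop7MGB.of_le h ha₀ ha₁

/-- The `CoP` edition is MONOTONE in `B₃'`. [cite: Balaban1985Variational, Thm 1 (9)–(10) p.279 (bookkeeping)] -/
theorem VariationalThm1C1RegSepCoP7MGB.mono {Adm : StepGuard F} {bd : BondDatum F} {Dat : TopData F N} {B₃ B₃' B₃'' a₀ a₁ : ℝ}
    (h : VariationalThm1C1RegSepCoP7MGB F N Adm bd Dat B₃ B₃' a₀ a₁) (hB : B₃' ≤ B₃'') : VariationalThm1C1RegSepCoP7MGB F N Adm bd Dat B₃ B₃'' a₀ a₁ :=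
  VariationalThm1C1RegSepTop7MGB.mono h hB

/-- The `CoP` edition is ANTITONE in the guard. [cite: Balaban1985Variational, Thm 1 (9)–(10) p.279; Balaban1987RG1, (0.1) p.251 (bookkeeping)] -/
theorem VariationalThm1C1RegSepCoP7MGB.of_imp {Adm Adm' : StepGuard F} {bd : BondDatum F} {Dat : TopData F N} {B₃ B₃' a₀ a₁ : ℝ}
    (h : VariationalThm1C1RegSepCoP7MGB F N Adm bd Dat B₃ B₃' a₀ a₁) (himp : ∀ ν M g K k s, Adm' ν M g K k s → Adm ν M g K k s) :
    VariationalThm1C1RegSepCoP7MGB F N Adm' bd Dat B₃ B₃' a₀ a₁ :=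
  VariationalThm1C1RegSepTop7MGB.of_imp h himp

/-- The `CoP` edition is ANTITONE in the data predicate. [cite: Balaban1985Variational, (7) p.278, Thm 1 (9)–(10) p.279 (bookkeeping)] -/
theorem VariationalThm1C1RegSepCoP7MGB.of_imp_dat {Adm : StepGuard F} {bd : BondDatum F} {Dat Dat' : TopData F N} {B₃ B₃' a₀ a₁ : ℝ}
    (h : VariationalThm1C1RegSepCoP7MGB F N Adm bd Dat B₃ B₃' a₀ a₁)
    (himp : ∀ (K : ℕ) (Ω : ℕ → Set (Site (F.P K) 0)) (Ω₀ : Set (Site (F.P K) 0)) (k : ℕ) (δ : ℕ → ℝ) (W : MSField (F.P K) (SU N)), Dat' K Ω Ω₀ k δ W → Dat K Ω Ω₀ k δ W) :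
    VariationalThm1C1RegSepCoP7MGB F N Adm bd Dat' B₃ B₃' a₀ a₁ :=
  VariationalThm1C1RegSepTop7MGB.of_imp_dat h himp

end NamedFactC1TopMGB

/-! ## §2  The pointwise accessor over `(bd, Dat)` -/

section AccessorsC1GB

variable {F : T4Family} {N : ℕ} [NeZero N]

/-- **★ EVERY `bd`-MINIMISER OVER THE TOP-DOMAIN CLASS (6) AT THE RECORD'S LETTERS MEETS THE C¹ CLASS BOUND `B₃'·cR·ε_n·η_n³` ON THE PLAQUETTE PAIRS INSIDE `Ω_n`, `1 ≤ n ≤ k`**, for a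
separated sequence, numerics with `M₁ ≥ 1`, a prefix passing the guard (`hadm`), thresholds comparable both ways and a datum satisfying `Dat`, from the guarded C¹ sentence over `(bd, Dat)`;
`εreg` generic — module C1 §2's `plaqC1SmallOn_of_thm1C1RegSepTop7M` over `(Adm, bd, Dat)`. [cite: Balaban1985Variational, Thm 1 (2),(6),(7),(9)–(10) pp.278–279, p.304 lines 1–2; Balaban1985RegularSpaces, (1.3) p.77; Balaban1984PropagatorsII, (2.3) p.224; Balaban1988Convergent, (2.6)–(2.8) pp.255–256, (2.12) p.256] -/
theorem plaqC1SmallOn_of_thm1C1RegSepTop7MGB {Sup : (ν : Stage7Numerics) → (K : ℕ) → (ℕ → Set (Site (F.P K) 0)) → Set (Site (F.P K) 0)} {Adm : StepGuard F} {bd : BondDatum F}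
    {Dat : TopData F N} {B₃ B₃' a₀ a₁ : ℝ} (h15C1 : VariationalThm1C1RegSepTop7MGB F N Sup Adm bd Dat B₃ B₃' a₀ a₁) (ν : Stage7Numerics) (M : ℕ)
    (g : ℕ → ℝ) (K k : ℕ) (cR : ℝ) (s : SeqOfRecord F ν M g K k) (hsep : Sect2.SeqSeparated ν.M₁ s) (hM₁ : 0 < ν.M₁) (hadm : Adm ν M g K k s)
    (hnum : ∀ n, n ≤ k → 0 < cR * epsOfRecord ν g n ∧ cR * epsOfRecord ν g n ≤ a₁ ∧ B₃ * (cR * epsOfRecord ν g n) ≤ ν.εreg) (ha₀ : ν.εreg ≤ a₀)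
    (hcomp : ∀ n, n < k → cR * epsOfRecord ν g n ≤ 2 * (cR * epsOfRecord ν g (n + 1)))
    (hcomp' : ∀ n, n < k → cR * epsOfRecord ν g (n + 1) ≤ 2 * (cR * epsOfRecord ν g n))
    {W : MSField (F.P K) (SU N)} (h7 : Dat K s.Ω (Sup ν K s.Ω) k (fun n => cR * epsOfRecord ν g n) W)
    {U₀ : GaugeField (F.P K) 0 (SU N)} (hmin : IsMinimizerB (avOfRecord F N K)
      {U | (∀ n, n ≤ k → PlaqSmallOn (Sect2.omegaPlaqsTop s.Ω (Sup ν K s.Ω) n) (ν.εreg * (F.P K).eta n ^ 2) U) ∧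
        Sect2.CoDivClassOnTop s.Ω (Sup ν K s.Ω) k ν.εreg U} (bd K k s.Ω) W U₀) :
    ∀ n, 1 ≤ n → n ≤ k → PlaqC1SmallOn (plaqInside (s.Ω n)) (B₃' * (cR * epsOfRecord ν g n) * (F.P K).eta n ^ 3) U₀ :=
  h15C1 ν M g K k s hsep hM₁ hadm ν.εreg (fun n => cR * epsOfRecord ν g n) hnum hcomp hcomp' ha₀ W h7 U₀ hmin

end AccessorsC1GB

end Literature.MathematicalPhysics.QuantumFieldTheory.Balaban1983to89.Node00

end
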